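/-
Copyright (c) 2026. All rights reserved.
Released under Apache 2.0 license as described in the file LICENSE.
Authors: abc-iut cell, prover seat abc-iut-f-101 (F fact-proving wave, gen 2), over abc-iut-L4-t5's toolkit.
-/
import Literature.AnabelianGeometry.AbsoluteAnabelian.DiagramUniversalFamilies

/-!
# Families of homotopies from RELATIVE lifts at a set of vertices ([AbsTopIII] Def. 3.5 (ii)–(iv), toolkit IIb)

S. Mochizuki, *Topics in Absolute Anabelian Geometry III*, Def. 3.5 (ii)–(iv) pp. 75–76 (manuscript
`paper:url-5493eb38cbb7`, bib key `MochizukiAbsTopIII2015`).  abc-iut-L4-t5's `DiagramUniversalFamilies.lean` builds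
the universal family of homotopies `univFamily O W` of a diagram of categories from the LIFTS `lift γ₁ γ₂` through
structure functors that are FULLY FAITHFUL at the vertices of `W` (`DiagramLifts.lean`): its boundary set is the set
`E_W` of pairs `([σ]∘[γ₁], [σ]∘[γ₂])` with `[γ₁], [γ₂]` co-verticial into some `w ∈ W`, and the construction uses of the
lifts exactly four properties — identity on the diagonal, transitivity, and compatibility with pre- and post-composition
of paths (`lift_self`, `lift_trans`, `lift_precomp_heq`, `lift_postcomp_heq`).

This file ABSTRACTS those four properties: a `RelLifts` datum on `𝒟` is a set of vertices `W`, at each vertex a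
relation `Rel` on co-verticial paths into it (closed under the saturation moves), and homotopies `θ` on related
pairs satisfying the four laws.  The same construction then yields a family of homotopies `relFamily` (Def. 3.5 (ii):
identity, composition, whiskering) whose boundary set consists of the pairs `([σ]∘[γ₁], [σ]∘[γ₂])` with
`([γ₁], [γ₂])` RELATED at some `w ∈ W` (`relE`), and whose homotopy on a related pair into `w ∈ W` is `θ`
(`relFamily_η_eq_θ`).  The point: `θ` need not come from a fully faithful structure functor — at a vertex whose
structure functor is NOT fully faithful one may still relate the paths of prescribed classes by prescribed
isomorphisms (consumer: the contact structure of [AbsTopIII] Cor 5.10 (iv)(c), whose contact pairs end at the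
vertex `𝒩⊢⊞_v`).  `RelLifts.ofOverData` recovers the fully faithful case (all pairs related, `θ = lift`), and
`relFamily_ofOverData_η_eq` identifies its homotopies with those of `univFamily`.  Pure category theory over
abc-iut-L4-t2's honest Def. 3.5 definitions; no claim of the paper is asserted; nothing here bears on [IUTchIII] Cor. 3.12.
-/

namespace Literature.AnabelianGeometry.AbsoluteAnabelian

open _root_.CategoryTheory _root_.Quiver

universe v u w

namespace DiagramOfCategories

variable {V : Type w} [Quiver.{v} V] (D : DiagramOfCategories.{v, u, w} V)

/-! ### Relative lifts -/

/-- **Relative lifts** on a diagram of categories `𝒟`: a set of vertices `W`; for co-verticial paths `[γ₁], [γ₂]` into a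
vertex a relation `Rel` ("the pair is to be a boundary pair"), stable under the saturation moves of §0 p. 26 —
(a) diagonal, (c) transitivity, (d) pre-composition, (e) post-composition by paths between vertices of `W`; and for
each related pair into `w ∈ W` a homotopy `θ : 𝒟_[γ₁] ⟶ 𝒟_[γ₂]` (Def. 3.5 (ii) (b)) which is the identity on the
diagonal, composes along (c), and is whiskered along (d), (e) (heterogeneously: `𝒟_[σ∘γ] = 𝒟_[σ] ∘ 𝒟_[γ]` holds
only propositionally).  abc-iut-L4-t5's lifts through fully faithful structure functors are the case `Rel = ⊤`
(`RelLifts.ofOverData`). [cite: MochizukiAbsTopIII2015, Definition 3.5 (ii) p.75] -/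
structure RelLifts : Type (max w (v + 1) (u + 1)) where
  /-- the vertices through which boundary pairs factor -/
  W : V → Prop
  /-- the related co-verticial pairs into a vertex -/
  Rel : ∀ ⦃a w : V⦄, Path a w → Path a w → Prop
  /-- the homotopy of a related pair into a vertex of `W` -/
  θ : ∀ ⦃a w : V⦄, W w → ∀ ⦃p q : Path a w⦄, Rel p q → (D.pathFunctor p ⟶ D.pathFunctor q)
  rel_refl_left : ∀ ⦃a w : V⦄ ⦃p q : Path a w⦄, W w → Rel p q → Rel p p
  rel_refl_right : ∀ ⦃a w : V⦄ ⦃p q : Path a w⦄, W w → Rel p q → Rel q q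
  rel_trans : ∀ ⦃a w : V⦄ ⦃p q r : Path a w⦄, W w → Rel p q → Rel q r → Rel p r
  rel_precomp : ∀ ⦃c a w : V⦄ (r : Path c a) ⦃p q : Path a w⦄, W w → Rel p q → Rel (r.comp p) (r.comp q)
  rel_postcomp : ∀ ⦃a w w' : V⦄ ⦃p q : Path a w⦄ (t : Path w w'), W w → W w' → Rel p q →
    Rel (p.comp t) (q.comp t)
  θ_self : ∀ ⦃a w : V⦄ (hw : W w) ⦃p : Path a w⦄ (h : Rel p p), θ hw h = 𝟙 _
  θ_trans : ∀ ⦃a w : V⦄ (hw : W w) ⦃p q r : Path a w⦄ (h₁ : Rel p q) (h₂ : Rel q r) (h₃ : Rel p r),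
    θ hw h₁ ≫ θ hw h₂ = θ hw h₃
  θ_precomp_heq : ∀ ⦃c a w : V⦄ (hw : W w) (r : Path c a) ⦃p q : Path a w⦄ (h : Rel p q)
    (h' : Rel (r.comp p) (r.comp q)), θ hw h' ≍ Functor.whiskerLeft (D.pathFunctor r) (θ hw h)
  θ_postcomp_heq : ∀ ⦃a w w' : V⦄ (hw : W w) (hw' : W w') ⦃p q : Path a w⦄ (t : Path w w') (h : Rel p q)
    (h' : Rel (p.comp t) (q.comp t)), θ hw' h' ≍ Functor.whiskerRight (θ hw h) (D.pathFunctor t)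

variable {D}

/-! ### Decompositions through a related pair and the boundary set -/

/-- A **decomposition through a related pair** of a co-verticial pair `(P, Q)`: `P = [σ]∘[γ₁]`, `Q = [σ]∘[γ₂]` with
`([γ₁], [γ₂])` RELATED into a vertex `w ∈ W` and a common suffix `[σ]` out of `w` (abc-iut-L4-t5's `Decomp` plus
the relation; Def. 3.5 (iv) (b) is the shape `([γ₃]∘[γ₁], [γ₃]∘[γ₂])`). [cite: MochizukiAbsTopIII2015, Definition 3.5 (iv) p.76] -/
structure RDecomp (R : D.RelLifts) {a b : V} (P Q : Path a b) : Type (max v w) where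
  /-- the intermediate vertex -/
  w : V
  mem : R.W w
  /-- the left prefix `[γ₁]` -/
  p : Path a w
  /-- the right prefix `[γ₂]` -/
  q : Path a w
  /-- the common suffix `[σ]` -/
  s : Path w b
  rel : R.Rel p q
  left_eq : P = p.comp s
  right_eq : Q = q.comp s

/-- The boundary set of the relative family: pairs admitting a decomposition through a related pair.
[cite: MochizukiAbsTopIII2015, Definition 3.5 (iv) p.76] -/
def relE (R : D.RelLifts) : ∀ ⦃a b : V⦄, Path a b → Path a b → Prop :=
  fun _ _ P Q => Nonempty (RDecomp R P Q)

/-- The boundary set of the relative family is saturated (§0 p. 26 (a)–(e); transitivity by nestedness of suffix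
decompositions, abc-iut-L4-t5's `path_suffix_nested`, moving the relation along the connecting path by
`rel_postcomp`). [cite: MochizukiAbsTopIII2015, Section 0 p.26] -/
theorem isSaturated_relE (R : D.RelLifts) : IsSaturated (relE (V := V) R) where
  refl_left _ _ _ _ := fun ⟨d⟩ =>
    ⟨⟨d.w, d.mem, d.p, d.p, d.s, R.rel_refl_left d.mem d.rel, d.left_eq, d.left_eq⟩⟩
  refl_right _ _ _ _ := fun ⟨d⟩ =>
    ⟨⟨d.w, d.mem, d.q, d.q, d.s, R.rel_refl_right d.mem d.rel, d.right_eq, d.right_eq⟩⟩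
  trans _ _ _ _ _ := fun ⟨d⟩ ⟨d'⟩ => by
    rcases path_suffix_nested d.s d'.s d.q d'.p (d.right_eq.symm.trans d'.left_eq) with
      ⟨t, ht⟩ | ⟨t, ht⟩
    · have hp' : d.q.comp t = d'.p := Path.comp_injective_left d'.s
        (show (d.q.comp t).comp d'.s = d'.p.comp d'.s by
          rw [Path.comp_assoc, ← ht]; exact d.right_eq.symm.trans d'.left_eq)
      refine ⟨⟨d'.w, d'.mem, d.p.comp t, d'.q, d'.s, ?_, by rw [Path.comp_assoc, ← ht]; exact d.left_eq,
        d'.right_eq⟩⟩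
      exact R.rel_trans d'.mem (hp' ▸ R.rel_postcomp t d.mem d'.mem d.rel) d'.rel
    · have hq : d'.p.comp t = d.q := Path.comp_injective_left d.s
        (show (d'.p.comp t).comp d.s = d.q.comp d.s by
          rw [Path.comp_assoc, ← ht]; exact d'.left_eq.symm.trans d.right_eq)
      refine ⟨⟨d.w, d.mem, d.p, d'.q.comp t, d.s, ?_, d.left_eq,
        by rw [Path.comp_assoc, ← ht]; exact d'.right_eq⟩⟩
      exact R.rel_trans d.mem d.rel (hq ▸ R.rel_postcomp t d'.mem d.mem d'.rel)
  precomp _ _ _ _ _ := fun ⟨d⟩ r =>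
    ⟨⟨d.w, d.mem, r.comp d.p, r.comp d.q, d.s, R.rel_precomp r d.mem d.rel, by rw [Path.comp_assoc, ← d.left_eq],
      by rw [Path.comp_assoc, ← d.right_eq]⟩⟩
  postcomp _ _ _ _ _ := fun ⟨d⟩ r =>
    ⟨⟨d.w, d.mem, d.p, d.q, d.s.comp r, d.rel, by rw [← Path.comp_assoc, ← d.left_eq],
      by rw [← Path.comp_assoc, ← d.right_eq]⟩⟩

/-- A RELATED pair into `w ∈ W` lies in the boundary set (trivial suffix).
[cite: MochizukiAbsTopIII2015, Definition 3.5 (iv) p.76] -/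
theorem relE_of_rel (R : D.RelLifts) {a w : V} (hw : R.W w) {p q : Path a w} (h : R.Rel p q) : relE R p q :=
  ⟨⟨w, hw, p, q, Path.nil, h, rfl, rfl⟩⟩

/-! ### The homotopy of a decomposition; well-definedness -/

section Relative

variable (R : D.RelLifts)

/-- `𝒟_[P] = 𝒟_[σ] ∘ 𝒟_[γ₁]` (Def. 3.5 (i)). [cite: MochizukiAbsTopIII2015, Definition 3.5 (i) p.75] -/
theorem RDecomp.pathFunctor_left {a b : V} {P Q : Path a b} (d : RDecomp R P Q) :
    D.pathFunctor P = D.pathFunctor d.p ⋙ D.pathFunctor d.s := by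
  rw [← pathFunctor_comp, ← d.left_eq]

/-- `𝒟_[Q] = 𝒟_[σ] ∘ 𝒟_[γ₂]` (Def. 3.5 (i)). [cite: MochizukiAbsTopIII2015, Definition 3.5 (i) p.75] -/
theorem RDecomp.pathFunctor_right {a b : V} {P Q : Path a b} (d : RDecomp R P Q) :
    D.pathFunctor Q = D.pathFunctor d.q ⋙ D.pathFunctor d.s := by
  rw [← pathFunctor_comp, ← d.right_eq]

/-- The homotopy attached to a decomposition: `θ(γ₁, γ₂) ▷ 𝒟_[σ]` (Def. 3.5 (ii) whiskering; Def. 3.5 (iv) (b)).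
[cite: MochizukiAbsTopIII2015, Definition 3.5 (iv) p.76] -/
noncomputable def RDecomp.η {a b : V} {P Q : Path a b} (d : RDecomp R P Q) :
    D.pathFunctor P ⟶ D.pathFunctor Q :=
  eqToHom (d.pathFunctor_left R) ≫
    Functor.whiskerRight (R.θ d.mem d.rel) (D.pathFunctor d.s) ≫ eqToHom (d.pathFunctor_right R).symm

/-- `RDecomp.η` is, heterogeneously, the whiskered `θ`. [folklore] -/
private theorem RDecomp.η_heq {a b : V} {P Q : Path a b} (d : RDecomp R P Q) :
    d.η R ≍ Functor.whiskerRight (R.θ d.mem d.rel) (D.pathFunctor d.s) :=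
  (conj_eqToHom_iff_heq _ _ (d.pathFunctor_left R) (d.pathFunctor_right R)).mp rfl

/-- Whiskering on the right respects heterogeneous equality (bookkeeping). [folklore] -/
private theorem whiskerRight_heq {A B B' : Type u} [Category.{v} A] [Category.{v} B]
    [Category.{v} B'] {F G F' G' : A ⥤ B} (hF : F = F') (hG : G = G') {α : F ⟶ G} {α' : F' ⟶ G'}
    (h : α ≍ α') {T T' : B ⥤ B'} (hT : T = T') :
    Functor.whiskerRight α T ≍ Functor.whiskerRight α' T' := by
  subst hF hG hT
  cases h
  rfl

/-- Whiskering on the left respects heterogeneous equality (bookkeeping). [folklore] -/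
private theorem whiskerLeft_heq {A A' B : Type u} [Category.{v} A] [Category.{v} A']
    [Category.{v} B] (L : A' ⥤ A) {F G F' G' : A ⥤ B} (hF : F = F') (hG : G = G') {α : F ⟶ G}
    {α' : F' ⟶ G'} (h : α ≍ α') : Functor.whiskerLeft L α ≍ Functor.whiskerLeft L α' := by
  subst hF hG
  cases h
  rfl

/-- Iterated right whiskering is right whiskering by the composite. [folklore] -/
private theorem whiskerRight_whiskerRight {A B B' B'' : Type u} [Category.{v} A] [Category.{v} B]
    [Category.{v} B'] [Category.{v} B''] {F G : A ⥤ B} (α : F ⟶ G) (T : B ⥤ B') (S : B' ⥤ B'') :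
    Functor.whiskerRight (Functor.whiskerRight α T) S = Functor.whiskerRight α (T ⋙ S) :=
  NatTrans.ext (funext fun _ => rfl)

/-- Right whiskering by the identity functor does nothing. [folklore] -/
private theorem whiskerRight_id_functor {A B : Type u} [Category.{v} A] [Category.{v} B]
    {F G : A ⥤ B} (α : F ⟶ G) : Functor.whiskerRight α (𝟭 B) = α :=
  NatTrans.ext (funext fun _ => rfl)

/-- `(L ◁ α) ▷ S = L ◁ (α ▷ S)`. [folklore] -/
private theorem whiskerRight_whiskerLeft {A A' B B' : Type u} [Category.{v} A] [Category.{v} A']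
    [Category.{v} B] [Category.{v} B'] (L : A' ⥤ A) {F G : A ⥤ B} (α : F ⟶ G) (S : B ⥤ B') :
    Functor.whiskerRight (Functor.whiskerLeft L α) S =
      Functor.whiskerLeft L (Functor.whiskerRight α S) :=
  NatTrans.ext (funext fun _ => rfl)

/-- Nested decompositions give the same homotopy (case `σ = τ∘σ'`; uses the post-composition law of `θ`). [folklore] -/
private theorem RDecomp.η_eq_of_suffix {a b : V} {P Q : Path a b} (d d' : RDecomp R P Q)
    (t : Path d.w d'.w) (ht : d.s = t.comp d'.s) : d.η R = d'.η R := by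
  obtain ⟨w, m, p, q, s, hr, hP, hQ⟩ := d
  obtain ⟨w', m', p', q', s', hr', hP', hQ'⟩ := d'
  dsimp only at t ht
  subst ht
  obtain rfl : p.comp t = p' := Path.comp_injective_left s'
    (show (p.comp t).comp s' = p'.comp s' by rw [Path.comp_assoc]; exact hP.symm.trans hP')
  obtain rfl : q.comp t = q' := Path.comp_injective_left s'
    (show (q.comp t).comp s' = q'.comp s' by rw [Path.comp_assoc]; exact hQ.symm.trans hQ')
  refine eq_of_heq ((RDecomp.η_heq R _).trans (HEq.trans ?_ (RDecomp.η_heq R _).symm))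
  dsimp only
  refine (whiskerRight_heq rfl rfl HEq.rfl (D.pathFunctor_comp t s')).trans ?_
  rw [← whiskerRight_whiskerRight]
  exact whiskerRight_heq (D.pathFunctor_comp p t).symm (D.pathFunctor_comp q t).symm
    (R.θ_postcomp_heq m m' t hr hr').symm rfl

/-- **Well-definedness**: any two decompositions through related pairs of the same pair give the same homotopy.
[cite: MochizukiAbsTopIII2015, Definition 3.5 (iv) p.76] -/
theorem RDecomp.η_eq {a b : V} {P Q : Path a b} (d d' : RDecomp R P Q) : d.η R = d'.η R := by
  rcases path_suffix_nested d.s d'.s d.p d'.p (d.left_eq.symm.trans d'.left_eq) with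
    ⟨t, ht⟩ | ⟨t, ht⟩
  · exact RDecomp.η_eq_of_suffix R d d' t ht
  · exact (RDecomp.η_eq_of_suffix R d' d t ht).symm

/-- The homotopy of the trivial decomposition (`σ` empty) is `θ` itself.
[cite: MochizukiAbsTopIII2015, Definition 3.5 (ii) p.75] -/
theorem RDecomp.η_nil {a w : V} (hw : R.W w) {p q : Path a w} (h : R.Rel p q) :
    (⟨w, hw, p, q, Path.nil, h, rfl, rfl⟩ : RDecomp R p q).η R = R.θ hw h := by
  refine eq_of_heq ((RDecomp.η_heq R _).trans ?_)
  change Functor.whiskerRight (R.θ hw h) (D.pathFunctor Path.nil) ≍ _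
  rw [pathFunctor_nil]
  exact heq_of_eq (whiskerRight_id_functor _)

/-- Transitivity of the decomposition homotopies along a common suffix (uses the composition law of `θ`). [folklore] -/
private theorem RDecomp.η_trans_aux {a b w : V} (hw : R.W w) (p q r : Path a w) (s : Path w b)
    {P Q S : Path a b} (hP : P = p.comp s) (hQ : Q = q.comp s) (hS : S = r.comp s)
    (h₁ : R.Rel p q) (h₂ : R.Rel q r) (h₃ : R.Rel p r) :
    (⟨w, hw, p, q, s, h₁, hP, hQ⟩ : RDecomp R P Q).η R ≫ (⟨w, hw, q, r, s, h₂, hQ, hS⟩ : RDecomp R Q S).η R =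
      (⟨w, hw, p, r, s, h₃, hP, hS⟩ : RDecomp R P S).η R := by
  simp only [RDecomp.η, Category.assoc, eqToHom_trans_assoc, eqToHom_refl, Category.id_comp]
  rw [← Category.assoc (Functor.whiskerRight _ _), ← Functor.whiskerRight_comp, R.θ_trans hw h₁ h₂ h₃]

/-! ### The relative family -/

/-- **The family of homotopies determined by relative lifts**: boundary set `relE` (pairs `([σ]∘[γ₁], [σ]∘[γ₂])`
with `([γ₁],[γ₂])` related into a vertex of `W`), homotopy `θ(γ₁, γ₂) ▷ 𝒟_[σ]`; the axioms of Def. 3.5 (ii)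
(identity, composition, whiskering) follow from the four laws of `θ`, exactly as for abc-iut-L4-t5's `univFamily`.
[cite: MochizukiAbsTopIII2015, Definition 3.5 (ii) p.75] -/
noncomputable def relFamily : D.HomotopyFamily where
  E := relE R
  isSaturated := isSaturated_relE R
  η := fun _ _ _ _ h => (Classical.choice h).η R
  η_refl := by
    intro a b P h
    let d := Classical.choice h
    show RDecomp.η R (Classical.choice h) = _
    rw [RDecomp.η_eq R (Classical.choice h)
      ⟨d.w, d.mem, d.p, d.p, d.s, R.rel_refl_left d.mem d.rel, d.left_eq, d.left_eq⟩]
    simp only [RDecomp.η, R.θ_self, Functor.whiskerRight_id', Category.id_comp, eqToHom_trans, eqToHom_refl]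
  η_trans := by
    intro a b P Q S h₁ h₂
    let d₁ := Classical.choice h₁
    let d₂ := Classical.choice h₂
    show RDecomp.η R (Classical.choice _) = RDecomp.η R (Classical.choice h₁) ≫ RDecomp.η R (Classical.choice h₂)
    rcases path_suffix_nested d₁.s d₂.s d₁.q d₂.p (d₁.right_eq.symm.trans d₂.left_eq) with
      ⟨t, ht⟩ | ⟨t, ht⟩
    · -- `σ₁ = τ ∘ σ₂`: re-decompose everything through `w₂`
      have hp₂ : d₁.q.comp t = d₂.p := Path.comp_injective_left d₂.s
        (show (d₁.q.comp t).comp d₂.s = d₂.p.comp d₂.s by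
          rw [Path.comp_assoc, ← ht]; exact d₁.right_eq.symm.trans d₂.left_eq)
      have hP : P = (d₁.p.comp t).comp d₂.s := by rw [Path.comp_assoc, ← ht]; exact d₁.left_eq
      have hQ : Q = (d₁.q.comp t).comp d₂.s := by rw [hp₂]; exact d₂.left_eq
      have r₁ : R.Rel (d₁.p.comp t) (d₁.q.comp t) := R.rel_postcomp t d₁.mem d₂.mem d₁.rel
      have r₂ : R.Rel (d₁.q.comp t) d₂.q := hp₂ ▸ d₂.rel
      rw [RDecomp.η_eq R (Classical.choice _)
          ⟨d₂.w, d₂.mem, d₁.p.comp t, d₂.q, d₂.s, R.rel_trans d₂.mem r₁ r₂, hP, d₂.right_eq⟩,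
        RDecomp.η_eq R (Classical.choice h₁) ⟨d₂.w, d₂.mem, d₁.p.comp t, d₁.q.comp t, d₂.s, r₁, hP, hQ⟩,
        RDecomp.η_eq R (Classical.choice h₂) ⟨d₂.w, d₂.mem, d₁.q.comp t, d₂.q, d₂.s, r₂, hQ, d₂.right_eq⟩,
        RDecomp.η_trans_aux]
    · -- `σ₂ = τ ∘ σ₁`: re-decompose everything through `w₁`
      have hq₁ : d₂.p.comp t = d₁.q := Path.comp_injective_left d₁.s
        (show (d₂.p.comp t).comp d₁.s = d₁.q.comp d₁.s by
          rw [Path.comp_assoc, ← ht]; exact d₂.left_eq.symm.trans d₁.right_eq)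
      have hS : S = (d₂.q.comp t).comp d₁.s := by rw [Path.comp_assoc, ← ht]; exact d₂.right_eq
      have hQ : Q = (d₂.p.comp t).comp d₁.s := by rw [hq₁]; exact d₁.right_eq
      have r₂ : R.Rel (d₂.p.comp t) (d₂.q.comp t) := R.rel_postcomp t d₂.mem d₁.mem d₂.rel
      have r₁ : R.Rel d₁.p (d₂.p.comp t) := hq₁ ▸ d₁.rel
      rw [RDecomp.η_eq R (Classical.choice _)
          ⟨d₁.w, d₁.mem, d₁.p, d₂.q.comp t, d₁.s, R.rel_trans d₁.mem r₁ r₂, d₁.left_eq, hS⟩,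
        RDecomp.η_eq R (Classical.choice h₁) ⟨d₁.w, d₁.mem, d₁.p, d₂.p.comp t, d₁.s, r₁, d₁.left_eq, hQ⟩,
        RDecomp.η_eq R (Classical.choice h₂) ⟨d₁.w, d₁.mem, d₂.p.comp t, d₂.q.comp t, d₁.s, r₂, hQ, hS⟩,
        RDecomp.η_trans_aux]
  η_whisker := by
    intro a b c e P Q h r₁ r₂
    let d := Classical.choice h
    have hP : r₁.comp (P.comp r₂) = (r₁.comp d.p).comp (d.s.comp r₂) := by
      rw [Path.comp_assoc, ← Path.comp_assoc d.p d.s r₂, ← d.left_eq]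
    have hQ : r₁.comp (Q.comp r₂) = (r₁.comp d.q).comp (d.s.comp r₂) := by
      rw [Path.comp_assoc, ← Path.comp_assoc d.q d.s r₂, ← d.right_eq]
    have hr : R.Rel (r₁.comp d.p) (r₁.comp d.q) := R.rel_precomp r₁ d.mem d.rel
    show RDecomp.η R (Classical.choice _) = eqToHom _ ≫ Functor.whiskerLeft (D.pathFunctor r₁)
      (Functor.whiskerRight (RDecomp.η R (Classical.choice h)) (D.pathFunctor r₂)) ≫ eqToHom _
    rw [RDecomp.η_eq R (Classical.choice _) ⟨d.w, d.mem, r₁.comp d.p, r₁.comp d.q, d.s.comp r₂, hr, hP, hQ⟩]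
    refine (conj_eqToHom_iff_heq' _ _ _ _).mpr ((RDecomp.η_heq R _).trans ?_)
    dsimp only
    have h1 : Functor.whiskerRight (R.θ d.mem hr) (D.pathFunctor (d.s.comp r₂)) ≍
        Functor.whiskerRight (Functor.whiskerLeft (D.pathFunctor r₁) (R.θ d.mem d.rel))
          (D.pathFunctor d.s ⋙ D.pathFunctor r₂) :=
      whiskerRight_heq (D.pathFunctor_comp r₁ d.p) (D.pathFunctor_comp r₁ d.q)
        (R.θ_precomp_heq d.mem r₁ d.rel hr) (D.pathFunctor_comp d.s r₂)
    have h2 : Functor.whiskerLeft (D.pathFunctor r₁)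
        (Functor.whiskerRight (RDecomp.η R (Classical.choice h)) (D.pathFunctor r₂)) ≍
        Functor.whiskerLeft (D.pathFunctor r₁) (Functor.whiskerRight
          (Functor.whiskerRight (R.θ d.mem d.rel) (D.pathFunctor d.s)) (D.pathFunctor r₂)) :=
      whiskerLeft_heq (D.pathFunctor r₁)
        (congrArg (· ⋙ D.pathFunctor r₂) (d.pathFunctor_left R))
        (congrArg (· ⋙ D.pathFunctor r₂) (d.pathFunctor_right R))
        (whiskerRight_heq (d.pathFunctor_left R) (d.pathFunctor_right R) (RDecomp.η_heq R d) rfl)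
    refine h1.trans (HEq.trans (heq_of_eq ?_) h2.symm)
    rw [whiskerRight_whiskerRight, whiskerRight_whiskerLeft]
    rfl

/-- The boundary set of the relative family is `relE`. [cite: MochizukiAbsTopIII2015, Definition 3.5 (ii) p.75] -/
theorem relFamily_E {a b : V} (P Q : Path a b) : (relFamily R).E P Q ↔ relE R P Q := Iff.rfl

/-- The homotopies of the relative family are computed by ANY decomposition through a related pair.
[cite: MochizukiAbsTopIII2015, Definition 3.5 (ii) p.75] -/
theorem relFamily_η_eq {a b : V} {P Q : Path a b} (h : (relFamily R).E P Q) (d : RDecomp R P Q) :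
    (relFamily R).η h = d.η R :=
  RDecomp.η_eq R _ d

/-- On a RELATED pair into a vertex `w ∈ W` the homotopy of the relative family is `θ`.
[cite: MochizukiAbsTopIII2015, Definition 3.5 (ii) p.75] -/
theorem relFamily_η_eq_θ {a w : V} (hw : R.W w) {p q : Path a w} (hr : R.Rel p q)
    (h : (relFamily R).E p q) : (relFamily R).η h = R.θ hw hr :=
  (relFamily_η_eq R h ⟨w, hw, p, q, Path.nil, hr, rfl, rfl⟩).trans (RDecomp.η_nil R hw hr)

end Relative

/-! ### The fully faithful case -/

section OfOverData

variable {C : Type u} [Category.{v} C] (O : D.OverData C) (W : V → Prop)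
  (hW : ∀ w, W w → (O.N w).FullyFaithful)

/-- abc-iut-L4-t5's lifts through structure functors fully faithful on `W` are relative lifts with ALL co-verticial
pairs related (`Rel = ⊤`, `θ = lift`; laws `lift_self`, `lift_trans`, `lift_precomp_heq`, `lift_postcomp_heq`).
[cite: MochizukiAbsTopIII2015, Remark 3.5.1 p.78] -/
noncomputable def RelLifts.ofOverData : D.RelLifts where
  W := W
  Rel := fun _ _ _ _ => True
  θ := fun _ _ hw p q _ => O.lift (hW _ hw) p q
  rel_refl_left := fun _ _ _ _ _ _ => trivial
  rel_refl_right := fun _ _ _ _ _ _ => trivial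
  rel_trans := fun _ _ _ _ _ _ _ _ => trivial
  rel_precomp := fun _ _ _ _ _ _ _ _ => trivial
  rel_postcomp := fun _ _ _ _ _ _ _ _ _ => trivial
  θ_self := fun _ _ hw p _ => O.lift_self (hW _ hw) p
  θ_trans := fun _ _ hw p q r _ _ _ => O.lift_trans (hW _ hw) p q r
  θ_precomp_heq := fun _ _ _ hw r p q _ _ => O.lift_precomp_heq (hW _ hw) r p q
  θ_postcomp_heq := fun _ _ _ hw hw' p q t _ _ => O.lift_postcomp_heq (hW _ hw) (hW _ hw') p q t

/-- In the fully faithful case the two boundary sets agree: `relE = E_W`.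
[cite: MochizukiAbsTopIII2015, Definition 3.5 (iv) p.76] -/
theorem relE_ofOverData_iff {a b : V} (P Q : Path a b) :
    relE (RelLifts.ofOverData O W hW) P Q ↔ univE W P Q :=
  ⟨fun ⟨d⟩ => ⟨⟨d.w, d.mem, d.p, d.q, d.s, d.left_eq, d.right_eq⟩⟩,
    fun ⟨d⟩ => ⟨⟨d.w, d.mem, d.p, d.q, d.s, trivial, d.left_eq, d.right_eq⟩⟩⟩

/-- In the fully faithful case the relative family has the homotopies of abc-iut-L4-t5's universal family.
[cite: MochizukiAbsTopIII2015, Definition 3.5 (ii) p.75] -/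
theorem relFamily_ofOverData_η_eq {a b : V} {P Q : Path a b} (h : (relFamily (RelLifts.ofOverData O W hW)).E P Q)
    (h' : (univFamily O W hW).E P Q) :
    (relFamily (RelLifts.ofOverData O W hW)).η h = (univFamily O W hW).η h' := by
  obtain ⟨d⟩ := h
  rw [relFamily_η_eq _ _ d, univFamily_η_eq O W hW h' ⟨d.w, d.mem, d.p, d.q, d.s, d.left_eq, d.right_eq⟩]
  rfl

end OfOverData

end DiagramOfCategories

end Literature.AnabelianGeometry.AbsoluteAnabelian
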